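import Summits.AtomisticToContinuum.HydrodynamicLimit.Theorems.OneFlightGossipEngineClampedCurrentsDockCutoff
import HarnessLib

/-!
# The re-orthogonalising cut: Gaussian preliminaries (helper file 1 of 2 of stub `stub_reorthCut`)

Crux `Summit.AtomisticToContinuum.HydrodynamicLimit.Theses.AntiMazurCoboundaries.KineticWindowGronwall`
(stmt-AtomisticToContinuum-9282, `= KineticFluxLdDecay → RelEntropyVanishing`), skeleton line `rare-band-ladder-dock`
(v2), registered stub `stub_reorthCut : ReorthogonalisingCut` (proved in file 2,
`…AntiMazurCoboundariesKineticWindowGronwallReorthCut.lean`, which imports this file). This file carries the registered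
helper stub `stub_reorthCutPrelim : ReorthCutPrelim` (the two orthogonality mechanisms of the cut, packaged).

Static Gaussian calculus on `ℝ³` under the standard Gaussian `γ = stdGaussian V3`, in the format of the toolkit
`OneFlightGossipEngineKineticCurrentsWindowLDUniformClassTruncationGauss` (radial weights `ω(‖w‖²)`, reflections and
swaps) and of `OneFlightGossipEngineClampedCurrentsDockCutoff` (cutoff `χ_L`, tent, `IsOpenPosMeasure γ`):

* orthogonality to the collision invariants `1, w_k, ‖w‖²` from the five moment identities (`orth_of_moments`), and of
  a difference of two orthogonal quadratic-growth profiles (`orth_sub`);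
* radial bumps `ω(‖w‖²)`, `0 ≤ ω ≤ 1`: positivity of `∫ ω`, `∫ w₀² ω` (the Gaussian charges open sets), the support
  bounds `S ∫ ω ≤ ∫ ω ‖w‖² ≤ S' ∫ ω`, vanishing odd moments;
* the moments of the bounded-shell re-orthogonaliser `ν = a₀ ζ_A(‖w‖²) + a₄ ζ_B(‖w‖²) + (∑ a_k w_k) ζ_A(‖w‖²)`
  (block-diagonal Gram system: the coordinates decouple by oddness and swaps) and the orthogonality of `F − ν` once
  `(a₀, a₄, a)` solve that system (`orth_corr`); the crude moment bound `|∫ F ψ| ≤ 4 sup|F|`;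
* two pieces of real arithmetic (Cramer bound, quadratic envelope off the bulk).

Everything here is folklore Gaussian calculus; nothing is cited and no Theses declaration is concluded.
-/

noncomputable section

open MeasureTheory ProbabilityTheory
open scoped ENNReal InnerProductSpace

namespace Summit.AtomisticToContinuum.HydrodynamicLimit.Theorems.KineticWindowGronwallReorthCut

open Literature.MathematicalPhysics.KineticTheory (V3 integral_norm_sq_stdGaussian
  integrable_norm_sq_stdGaussian)
open KineticCurrentsWindowLDUniformSketch.ClassTruncation
open ClampedCurrentsDockCutoff (isOpenPosMeasure_stdGaussian_V3 cutoff_eq_one tent_props abs_lin_le)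
open KineticFluxLdDecayTilt (integral_eq_zero_of_odd_stdGaussian)

/-! ### Orthogonality to the collision invariants from the five moments -/

/-- `|c₀ + ⟪b, v⟫ + c₂ ‖v‖²| ≤ (|c₀| + ‖b‖ + |c₂|)(1 + ‖v‖²)`. [folklore] -/
theorem abs_affine_le (c₀ c₂ : ℝ) (b v : V3) :
    |c₀ + inner ℝ b v + c₂ * ‖v‖ ^ 2| ≤ (|c₀| + ‖b‖ + |c₂|) * (1 + ‖v‖ ^ 2) := by
  have h1 : |inner ℝ b v| ≤ ‖b‖ * (1 + ‖v‖ ^ 2) :=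
    (abs_real_inner_le_norm b v).trans (mul_le_mul_of_nonneg_left
      (by nlinarith [norm_nonneg v, sq_nonneg (‖v‖ - 1)]) (norm_nonneg _))
  calc |c₀ + inner ℝ b v + c₂ * ‖v‖ ^ 2| ≤ |c₀| + |inner ℝ b v| + |c₂| * ‖v‖ ^ 2 := by
        refine (abs_add_le _ _).trans (add_le_add (abs_add_le _ _) ?_)
        rw [abs_mul, abs_of_nonneg (sq_nonneg ‖v‖)]
    _ ≤ _ := by nlinarith [abs_nonneg c₀, abs_nonneg c₂, sq_nonneg ‖v‖, h1]

/-- A continuous function of quadratic growth is integrable against `c₀ + ⟪b, v⟫ + c₂ ‖v‖²` under `γ`.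
[folklore] -/
theorem integrable_mul_affine {g : V3 → ℝ} (hgc : Continuous g) {K : ℝ}
    (hgb : ∀ w, |g w| ≤ K * (1 + ‖w‖ ^ 2)) (c₀ c₂ : ℝ) (b : V3) :
    Integrable (fun v => g v * (c₀ + inner ℝ b v + c₂ * ‖v‖ ^ 2)) (stdGaussian V3) := by
  refine integrable_of_le_cube (by fun_prop) (K * (|c₀| + ‖b‖ + |c₂|) * 1) fun v => ?_
  rw [← mul_one (g v * _)]
  exact abs_mul_three_le (hgb v) (abs_affine_le c₀ c₂ b v)
    (by rw [abs_one]; nlinarith [sq_nonneg ‖v‖])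

/-- **Orthogonality from the five moments.** A continuous `G` of quadratic growth with
`∫ G = ∫ G w_j = ∫ G ‖w‖² = 0` is orthogonal to every `c₀ + ⟪b, w⟫ + c₂ ‖w‖²` under `γ`. [folklore] -/
theorem orth_of_moments {G : V3 → ℝ} (hGc : Continuous G) {K : ℝ}
    (hGb : ∀ w, |G w| ≤ K * (1 + ‖w‖ ^ 2)) (h0 : ∫ w, G w ∂stdGaussian V3 = 0)
    (h1 : ∀ j, ∫ w, G w * w j ∂stdGaussian V3 = 0)
    (h2 : ∫ w, G w * ‖w‖ ^ 2 ∂stdGaussian V3 = 0) (c₀ c₂ : ℝ) (b : V3) :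
    ∫ v, G v * (c₀ + inner ℝ b v + c₂ * ‖v‖ ^ 2) ∂stdGaussian V3 = 0 := by
  obtain ⟨hi0, hi1, hi2⟩ := integrable_of_le_lin hGc hGb
  have hexp : (fun v : V3 => G v * (c₀ + inner ℝ b v + c₂ * ‖v‖ ^ 2)) =
      fun v => c₀ * G v + ∑ j, b j * (G v * v j) + c₂ * (G v * ‖v‖ ^ 2) := by
    funext v
    have hin : inner ℝ b v = ∑ j, b j * v j := by simp [PiLp.inner_apply, mul_comm]
    have hs : G v * ∑ j, b j * v j = ∑ j, b j * (G v * v j) := by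
      rw [Finset.mul_sum]; exact Finset.sum_congr rfl fun j _ => by ring
    rw [hin, mul_add, mul_add, hs]; ring
  have his : Integrable (fun v : V3 => ∑ j, b j * (G v * v j)) (stdGaussian V3) :=
    integrable_finsetSum _ fun j _ => (hi1 j).const_mul _
  have h01 : Integrable (fun v : V3 => c₀ * G v + ∑ j, b j * (G v * v j)) (stdGaussian V3) :=
    (hi0.const_mul _).add his
  rw [hexp, integral_add h01 (hi2.const_mul _),
    integral_add (hi0.const_mul _) his, integral_const_mul, integral_const_mul,
    integral_finsetSum _ fun j _ => (hi1 j).const_mul _, h0, h2]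
  simp only [integral_const_mul, h1, mul_zero, Finset.sum_const_zero, add_zero]

/-- **Orthogonality of a difference**: if `g` and `G` (continuous, quadratic growth) are both orthogonal to
`c₀ + ⟪b, w⟫ + c₂ ‖w‖²`, so is `g − G`. [folklore] -/
theorem orth_sub {g G : V3 → ℝ} (hgc : Continuous g) (hGc : Continuous G) {K K' : ℝ}
    (hgb : ∀ w, |g w| ≤ K * (1 + ‖w‖ ^ 2)) (hGb : ∀ w, |G w| ≤ K' * (1 + ‖w‖ ^ 2)) (c₀ c₂ : ℝ)
    (b : V3) (hg : ∫ v, g v * (c₀ + inner ℝ b v + c₂ * ‖v‖ ^ 2) ∂stdGaussian V3 = 0)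
    (hG : ∫ v, G v * (c₀ + inner ℝ b v + c₂ * ‖v‖ ^ 2) ∂stdGaussian V3 = 0) :
    ∫ v, (g v - G v) * (c₀ + inner ℝ b v + c₂ * ‖v‖ ^ 2) ∂stdGaussian V3 = 0 := by
  simp_rw [sub_mul]
  rw [integral_sub (integrable_mul_affine hgc hgb c₀ c₂ b) (integrable_mul_affine hGc hGb c₀ c₂ b),
    hg, hG, sub_zero]

/-! ### Radial bumps under the standard Gaussian -/

/-- A weight with values in `[0,1]` has the linear-growth bound of the toolkit. [folklore] -/
theorem weight_abs_le {ω : ℝ → ℝ} (h0 : ∀ s, 0 ≤ ω s) (h1 : ∀ s, ω s ≤ 1) (s : ℝ) (hs : 0 ≤ s) :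
    |ω s| ≤ 1 * (1 + s) := by
  rw [abs_of_nonneg (h0 s), one_mul]; linarith [h1 s]

/-- A radial weight with values in `[0,1]` has quadratic growth (crudely). [folklore] -/
theorem weight_abs_le' {ω : ℝ → ℝ} (h0 : ∀ s, 0 ≤ ω s) (h1 : ∀ s, ω s ≤ 1) (w : V3) :
    |ω (‖w‖ ^ 2)| ≤ 1 * (1 + ‖w‖ ^ 2) :=
  weight_abs_le h0 h1 _ (sq_nonneg _)

/-- `∫ ω(‖w‖²) dγ > 0` for a continuous radial weight `0 ≤ ω ≤ 1` not vanishing at some `t ≥ 0`.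
[folklore] -/
theorem integral_weight_pos {ω : ℝ → ℝ} (hω : Continuous ω) (h0 : ∀ s, 0 ≤ ω s) (h1 : ∀ s, ω s ≤ 1)
    {t : ℝ} (ht : 0 ≤ t) (hωt : ω t ≠ 0) : 0 < ∫ w, ω (‖w‖ ^ 2) ∂stdGaussian V3 := by
  haveI := isOpenPosMeasure_stdGaussian_V3
  have hn : ‖(EuclideanSpace.single (0 : Fin 3) (Real.sqrt t) : V3)‖ ^ 2 = t := by
    rw [PiLp.norm_single, Real.norm_eq_abs, sq_abs, Real.sq_sqrt ht]
  refine integral_pos_of_integrable_nonneg_nonzero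
    (x := (EuclideanSpace.single (0 : Fin 3) (Real.sqrt t) : V3)) (by fun_prop)
    (integrable_of_le_lin (by fun_prop) (weight_abs_le' h0 h1)).1 (fun w => h0 _) ?_
  rwa [hn]

/-- `∫ w₀² ω(‖w‖²) dγ > 0` for a continuous radial weight `0 ≤ ω ≤ 1` not vanishing at some `t > 0`.
[folklore] -/
theorem integral_coord_sq_weight_pos {ω : ℝ → ℝ} (hω : Continuous ω) (h0 : ∀ s, 0 ≤ ω s)
    (h1 : ∀ s, ω s ≤ 1) {t : ℝ} (ht : 0 < t) (hωt : ω t ≠ 0) :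
    0 < ∫ w, w 0 * w 0 * ω (‖w‖ ^ 2) ∂stdGaussian V3 := by
  haveI := isOpenPosMeasure_stdGaussian_V3
  have hpt : (EuclideanSpace.single (0 : Fin 3) (Real.sqrt t) : V3) 0 = Real.sqrt t := by simp
  have hn : ‖(EuclideanSpace.single (0 : Fin 3) (Real.sqrt t) : V3)‖ ^ 2 = t := by
    rw [PiLp.norm_single, Real.norm_eq_abs, sq_abs, Real.sq_sqrt ht.le]
  refine integral_pos_of_integrable_nonneg_nonzero
    (x := (EuclideanSpace.single (0 : Fin 3) (Real.sqrt t) : V3)) (by fun_prop)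
    (integrable_coord_mul_weight 0 0 hω (weight_abs_le h0 h1))
    (fun w => mul_nonneg (mul_self_nonneg _) (h0 _)) ?_
  beta_reduce
  rw [hpt, hn, Real.mul_self_sqrt ht.le]
  exact mul_ne_zero ht.ne' hωt

/-- Upper support bound: if `ω = 0` on `[S, ∞)` then `∫ ω(‖w‖²) ‖w‖² dγ ≤ S ∫ ω(‖w‖²) dγ`. [folklore] -/
theorem integral_weight_norm_sq_le {ω : ℝ → ℝ} (hω : Continuous ω) (h0 : ∀ s, 0 ≤ ω s)
    (h1 : ∀ s, ω s ≤ 1) {S : ℝ} (hS : ∀ s, S ≤ s → ω s = 0) :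
    ∫ w, ω (‖w‖ ^ 2) * ‖w‖ ^ 2 ∂stdGaussian V3 ≤ S * ∫ w, ω (‖w‖ ^ 2) ∂stdGaussian V3 := by
  obtain ⟨hi, -, his⟩ := integrable_of_le_lin (by fun_prop) (weight_abs_le' h0 h1) (h := fun w => ω (‖w‖ ^ 2))
  rw [← integral_const_mul]
  refine integral_mono his (hi.const_mul S) fun w => ?_
  beta_reduce
  by_cases h : S ≤ ‖w‖ ^ 2
  · rw [hS _ h, zero_mul, mul_zero]
  · rw [mul_comm]; exact mul_le_mul_of_nonneg_right (not_le.1 h).le (h0 _)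

/-- Lower support bound: if `ω = 0` on `(-∞, S]` then `S ∫ ω(‖w‖²) dγ ≤ ∫ ω(‖w‖²) ‖w‖² dγ`. [folklore] -/
theorem le_integral_weight_norm_sq {ω : ℝ → ℝ} (hω : Continuous ω) (h0 : ∀ s, 0 ≤ ω s)
    (h1 : ∀ s, ω s ≤ 1) {S : ℝ} (hS : ∀ s, s ≤ S → ω s = 0) :
    S * ∫ w, ω (‖w‖ ^ 2) ∂stdGaussian V3 ≤ ∫ w, ω (‖w‖ ^ 2) * ‖w‖ ^ 2 ∂stdGaussian V3 := by
  obtain ⟨hi, -, his⟩ := integrable_of_le_lin (by fun_prop) (weight_abs_le' h0 h1) (h := fun w => ω (‖w‖ ^ 2))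
  rw [← integral_const_mul]
  refine integral_mono (hi.const_mul S) his fun w => ?_
  beta_reduce
  by_cases h : ‖w‖ ^ 2 ≤ S
  · rw [hS _ h, zero_mul, mul_zero]
  · rw [mul_comm]; exact mul_le_mul_of_nonneg_left (not_le.1 h).le (h0 _)

/-- `|∑ a_k w_k| ≤ 3A(1 + ‖w‖²)` when `|a_k| ≤ A`. [folklore] -/
theorem abs_lin_le_of_coord {a : V3} {A : ℝ} (ha : ∀ k, |a k| ≤ A) (w : V3) :
    |∑ k, a k * w k| ≤ 3 * A * (1 + ‖w‖ ^ 2) := by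
  calc |∑ k, a k * w k| ≤ ∑ k, |a k * w k| := Finset.abs_sum_le_sum_abs _ _
    _ ≤ ∑ _k : Fin 3, A * (1 + ‖w‖ ^ 2) := Finset.sum_le_sum fun k _ => by
        rw [abs_mul]
        exact mul_le_mul (ha k) (abs_coord_le w k) (abs_nonneg _) ((abs_nonneg _).trans (ha k))
    _ = 3 * A * (1 + ‖w‖ ^ 2) := by
        rw [Finset.sum_const, Finset.card_univ, Fintype.card_fin]; ring

/-! ### Moments of the bounded-shell re-orthogonaliser -/

/-- Moments of the even (radial) part `a₀ ζ_A(‖w‖²) + a₄ ζ_B(‖w‖²)`: against `1` and `‖w‖²` they are the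
corresponding combinations of `∫ ζ`, `∫ ζ ‖w‖²`; against `w_j` they vanish by oddness. [folklore] -/
theorem even_corr_moments {ζA ζB : ℝ → ℝ} (hA : Continuous ζA) (hA0 : ∀ s, 0 ≤ ζA s)
    (hA1 : ∀ s, ζA s ≤ 1) (hB : Continuous ζB) (hB0 : ∀ s, 0 ≤ ζB s) (hB1 : ∀ s, ζB s ≤ 1)
    (a₀ a₄ : ℝ) :
    (∫ w, (a₀ * ζA (‖w‖ ^ 2) + a₄ * ζB (‖w‖ ^ 2)) ∂stdGaussian V3 =
        a₀ * ∫ w, ζA (‖w‖ ^ 2) ∂stdGaussian V3 + a₄ * ∫ w, ζB (‖w‖ ^ 2) ∂stdGaussian V3) ∧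
      (∀ j, ∫ w, (a₀ * ζA (‖w‖ ^ 2) + a₄ * ζB (‖w‖ ^ 2)) * w j ∂stdGaussian V3 = 0) ∧
      ∫ w, (a₀ * ζA (‖w‖ ^ 2) + a₄ * ζB (‖w‖ ^ 2)) * ‖w‖ ^ 2 ∂stdGaussian V3 =
        a₀ * ∫ w, ζA (‖w‖ ^ 2) * ‖w‖ ^ 2 ∂stdGaussian V3 +
          a₄ * ∫ w, ζB (‖w‖ ^ 2) * ‖w‖ ^ 2 ∂stdGaussian V3 := by
  obtain ⟨hiA, -, hiAs⟩ := integrable_of_le_lin (by fun_prop) (weight_abs_le' hA0 hA1)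
    (h := fun w => ζA (‖w‖ ^ 2))
  obtain ⟨hiB, -, hiBs⟩ := integrable_of_le_lin (by fun_prop) (weight_abs_le' hB0 hB1)
    (h := fun w => ζB (‖w‖ ^ 2))
  refine ⟨?_, fun j => ?_, ?_⟩
  · rw [integral_add (hiA.const_mul _) (hiB.const_mul _), integral_const_mul, integral_const_mul]
  · exact integral_eq_zero_of_odd_stdGaussian fun w => by
      simp only [norm_neg, PiLp.neg_apply, mul_neg]
  · have h : (fun w : V3 => (a₀ * ζA (‖w‖ ^ 2) + a₄ * ζB (‖w‖ ^ 2)) * ‖w‖ ^ 2) =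
        fun w => a₀ * (ζA (‖w‖ ^ 2) * ‖w‖ ^ 2) + a₄ * (ζB (‖w‖ ^ 2) * ‖w‖ ^ 2) := by
      funext w; ring
    rw [h, integral_add (hiAs.const_mul _) (hiBs.const_mul _), integral_const_mul,
      integral_const_mul]

/-- Moments of the odd part `(∑ a_k w_k) ζ_A(‖w‖²)`: against `1` and `‖w‖²` they vanish by oddness;
against `w_j` it is `a_j ∫ w₀² ζ_A` (reflections and swaps, toolkit `integral_lin_mul_coord_weight`).
[folklore] -/
theorem odd_corr_moments {ζA : ℝ → ℝ} (hA : Continuous ζA) (hA0 : ∀ s, 0 ≤ ζA s)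
    (hA1 : ∀ s, ζA s ≤ 1) (a : V3) :
    (∫ w, (∑ k, a k * w k) * ζA (‖w‖ ^ 2) ∂stdGaussian V3 = 0) ∧
      (∀ j, ∫ w, (∑ k, a k * w k) * ζA (‖w‖ ^ 2) * w j ∂stdGaussian V3 =
        a j * ∫ w, w 0 * w 0 * ζA (‖w‖ ^ 2) ∂stdGaussian V3) ∧
      ∫ w, (∑ k, a k * w k) * ζA (‖w‖ ^ 2) * ‖w‖ ^ 2 ∂stdGaussian V3 = 0 := by
  refine ⟨?_, fun j => ?_, ?_⟩
  · exact integral_eq_zero_of_odd_stdGaussian fun w => by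
      simp only [norm_neg, PiLp.neg_apply, mul_neg, Finset.sum_neg_distrib, neg_mul]
  · have h : (fun w : V3 => (∑ k, a k * w k) * ζA (‖w‖ ^ 2) * w j) =
        fun w => (∑ k, a k * w k) * w j * ζA (‖w‖ ^ 2) := by
      funext w; ring
    rw [h, integral_lin_mul_coord_weight a j hA (weight_abs_le hA0 hA1)]
  · exact integral_eq_zero_of_odd_stdGaussian fun w => by
      simp only [norm_neg, PiLp.neg_apply, mul_neg, Finset.sum_neg_distrib, neg_mul]

/-- Crude Gaussian moment bound: `|∫ F ψ dγ| ≤ 4B` if `|F| ≤ B` and `|ψ| ≤ 1 + ‖w‖²` (`∫ (1 + ‖w‖²) dγ = 4`).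
[folklore] -/
theorem abs_integral_mul_le {F ψ : V3 → ℝ} {B : ℝ} (hFb : ∀ w, |F w| ≤ B)
    (hψ : ∀ w, |ψ w| ≤ 1 + ‖w‖ ^ 2) :
    |∫ w, F w * ψ w ∂stdGaussian V3| ≤ 4 * B := by
  have hB : 0 ≤ B := (abs_nonneg _).trans (hFb 0)
  have hi : Integrable (fun w : V3 => B * (1 + ‖w‖ ^ 2)) (stdGaussian V3) :=
    ((integrable_const (1 : ℝ)).add integrable_norm_sq_stdGaussian).const_mul B
  calc |∫ w, F w * ψ w ∂stdGaussian V3| ≤ ∫ w, |F w * ψ w| ∂stdGaussian V3 :=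
        abs_integral_le_integral_abs
    _ ≤ ∫ w, B * (1 + ‖w‖ ^ 2) ∂stdGaussian V3 := by
        refine integral_mono_of_nonneg (ae_of_all _ fun w => abs_nonneg _) hi
          (ae_of_all _ fun w => ?_)
        show |F w * ψ w| ≤ B * (1 + ‖w‖ ^ 2)
        rw [abs_mul]
        exact mul_le_mul (hFb w) (hψ w) (abs_nonneg _) hB
    _ = 4 * B := by
        rw [integral_const_mul, integral_add (integrable_const _) integrable_norm_sq_stdGaussian,
          integral_const, integral_norm_sq_stdGaussian, probReal_univ, Fintype.card_fin, one_smul]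
        norm_num; ring

/-- **The re-orthogonalised cut-off is orthogonal.** For a continuous `F` of quadratic growth, radial
weights `0 ≤ ζ_A, ζ_B ≤ 1`, and coefficients `(a₀, a₄, a)` solving the block-diagonal Gram system
`a₀ ∫ζ_A + a₄ ∫ζ_B = ∫F`, `a_j ∫ w₀² ζ_A = ∫ F w_j`, `a₀ ∫ζ_A‖w‖² + a₄ ∫ζ_B‖w‖² = ∫ F‖w‖²`, the function
`F − a₀ζ_A − a₄ζ_B − (∑ a_k w_k)ζ_A` is orthogonal to `1, w_k, ‖w‖²` under `γ`. [folklore] -/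
theorem orth_corr {F : V3 → ℝ} {ζA ζB : ℝ → ℝ} (hFc : Continuous F) {KF : ℝ}
    (hFb : ∀ w, |F w| ≤ KF * (1 + ‖w‖ ^ 2))
    (hA : Continuous ζA) (hA0 : ∀ s, 0 ≤ ζA s) (hA1 : ∀ s, ζA s ≤ 1)
    (hB : Continuous ζB) (hB0 : ∀ s, 0 ≤ ζB s) (hB1 : ∀ s, ζB s ≤ 1) {a₀ a₄ : ℝ} {a : V3}
    (e₀ : a₀ * ∫ w, ζA (‖w‖ ^ 2) ∂stdGaussian V3 + a₄ * ∫ w, ζB (‖w‖ ^ 2) ∂stdGaussian V3 =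
      ∫ w, F w ∂stdGaussian V3)
    (e : ∀ j, a j * ∫ w, w 0 * w 0 * ζA (‖w‖ ^ 2) ∂stdGaussian V3 =
      ∫ w, F w * w j ∂stdGaussian V3)
    (e₄ : a₀ * ∫ w, ζA (‖w‖ ^ 2) * ‖w‖ ^ 2 ∂stdGaussian V3 +
        a₄ * ∫ w, ζB (‖w‖ ^ 2) * ‖w‖ ^ 2 ∂stdGaussian V3 =
      ∫ w, F w * ‖w‖ ^ 2 ∂stdGaussian V3) (c₀ c₂ : ℝ) (b : V3) :
    ∫ v, (F v - (a₀ * ζA (‖v‖ ^ 2) + a₄ * ζB (‖v‖ ^ 2)) - (∑ k, a k * v k) * ζA (‖v‖ ^ 2)) *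
      (c₀ + inner ℝ b v + c₂ * ‖v‖ ^ 2) ∂stdGaussian V3 = 0 := by
  have hEb : ∀ w : V3, |a₀ * ζA (‖w‖ ^ 2) + a₄ * ζB (‖w‖ ^ 2)| ≤ (|a₀| + |a₄|) * (1 + ‖w‖ ^ 2) := by
    intro w
    calc _ ≤ |a₀ * ζA (‖w‖ ^ 2)| + |a₄ * ζB (‖w‖ ^ 2)| := abs_add_le _ _
      _ ≤ |a₀| + |a₄| := by
          rw [abs_mul, abs_mul, abs_of_nonneg (hA0 _), abs_of_nonneg (hB0 _)]
          exact add_le_add (mul_le_of_le_one_right (abs_nonneg _) (hA1 _))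
            (mul_le_of_le_one_right (abs_nonneg _) (hB1 _))
      _ ≤ _ := le_mul_one_add le_rfl (by positivity) (sq_nonneg _)
  have hOb : ∀ w : V3, |(∑ k, a k * w k) * ζA (‖w‖ ^ 2)| ≤ ‖a‖ * (1 + ‖w‖ ^ 2) := by
    intro w
    rw [abs_mul, abs_of_nonneg (hA0 _)]
    calc _ ≤ ‖a‖ * (1 + ‖w‖ ^ 2) * 1 := mul_le_mul (abs_lin_le a w) (hA1 _) (hA0 _) (by positivity)
      _ = _ := mul_one _
  obtain ⟨hiF, hiFj, hiFs⟩ := integrable_of_le_lin hFc hFb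
  obtain ⟨hiE, hiEj, hiEs⟩ := integrable_of_le_lin (by fun_prop) hEb
  obtain ⟨hiO, hiOj, hiOs⟩ := integrable_of_le_lin (by fun_prop) hOb
  obtain ⟨mE0, mEj, mEs⟩ := even_corr_moments hA hA0 hA1 hB hB0 hB1 a₀ a₄
  obtain ⟨mO0, mOj, mOs⟩ := odd_corr_moments hA hA0 hA1 a
  have hGb : ∀ w : V3, |F w - (a₀ * ζA (‖w‖ ^ 2) + a₄ * ζB (‖w‖ ^ 2)) -
      (∑ k, a k * w k) * ζA (‖w‖ ^ 2)| ≤ (KF + (|a₀| + |a₄|) + ‖a‖) * (1 + ‖w‖ ^ 2) := by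
    intro w
    calc _ ≤ |F w - (a₀ * ζA (‖w‖ ^ 2) + a₄ * ζB (‖w‖ ^ 2))| +
        |(∑ k, a k * w k) * ζA (‖w‖ ^ 2)| := abs_sub _ _
      _ ≤ |F w| + |a₀ * ζA (‖w‖ ^ 2) + a₄ * ζB (‖w‖ ^ 2)| +
        |(∑ k, a k * w k) * ζA (‖w‖ ^ 2)| := by gcongr; exact abs_sub _ _
      _ ≤ KF * (1 + ‖w‖ ^ 2) + (|a₀| + |a₄|) * (1 + ‖w‖ ^ 2) + ‖a‖ * (1 + ‖w‖ ^ 2) :=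
        add_le_add (add_le_add (hFb w) (hEb w)) (hOb w)
      _ = _ := by ring
  refine orth_of_moments (by fun_prop) hGb ?_ (fun j => ?_) ?_ c₀ c₂ b
  · rw [integral_sub (hiF.sub' hiE) hiO, integral_sub hiF hiE, mE0, mO0, ← e₀]; ring
  · simp_rw [sub_mul]
    rw [integral_sub ((hiFj j).sub' (hiEj j)) (hiOj j), integral_sub (hiFj j) (hiEj j), mEj j,
      mOj j, ← e j]; ring
  · simp_rw [sub_mul]
    rw [integral_sub (hiFs.sub' hiEs) hiOs, integral_sub hiFs hiEs, mEs, mOs, ← e₄]; ring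

/-! ### Two pieces of real arithmetic -/

/-- Cramer bound: `|(x p − y q)/D| ≤ c P (p + q)/D` when `|x|, |y| ≤ c P`, `p, q ≥ 0`, `D > 0`. [folklore] -/
theorem cramer_abs_le {x y p q D c P : ℝ} (hD : 0 < D) (hp : 0 ≤ p) (hq : 0 ≤ q)
    (hx : |x| ≤ c * P) (hy : |y| ≤ c * P) :
    |(x * p - y * q) / D| ≤ c * (P * (p + q) / D) := by
  rw [abs_div, abs_of_pos hD, mul_div_assoc', div_le_div_iff_of_pos_right hD]
  calc |x * p - y * q| ≤ |x * p| + |y * q| := abs_sub _ _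
    _ = |x| * p + |y| * q := by rw [abs_mul, abs_mul, abs_of_nonneg hp, abs_of_nonneg hq]
    _ ≤ c * P * p + c * P * q :=
      add_le_add (mul_le_mul_of_nonneg_right hx hp) (mul_le_mul_of_nonneg_right hy hq)
    _ = c * (P * (p + q)) := by ring

/-- The quadratic envelope off the bulk: if `0 < L ≤ s`, `|x| ≤ c(1 + s)`, `|e| ≤ c B_e`, `|o| ≤ c B_o`, then
`|x + e + o| ≤ K c s` for every `K ≥ 1/L + 1 + (B_e + B_o)/L`. [folklore] -/
theorem envelope_abs_le {x e o c s L Be Bo K : ℝ} (hc : 0 ≤ c) (hL : 0 < L) (hs : L ≤ s)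
    (hBe : 0 ≤ Be) (hBo : 0 ≤ Bo) (hK : 1 / L + 1 + (Be + Bo) / L ≤ K)
    (hx : |x| ≤ c * (1 + s)) (he : |e| ≤ c * Be) (ho : |o| ≤ c * Bo) :
    |x + e + o| ≤ K * c * s := by
  have hs0 : 0 ≤ s := hL.le.trans hs
  have hsL : 1 ≤ s / L := by rwa [le_div_iff₀ hL, one_mul]
  have h1 : (1 + (Be + Bo)) * 1 ≤ (1 + (Be + Bo)) * (s / L) :=
    mul_le_mul_of_nonneg_left hsL (by positivity)
  have key : (1 + s) + (Be + Bo) ≤ (1 / L + 1 + (Be + Bo) / L) * s := by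
    have h : (1 / L + 1 + (Be + Bo) / L) * s = (1 + (Be + Bo)) * (s / L) + s := by ring
    rw [h]; linarith
  calc |x + e + o| ≤ |x| + |e| + |o| :=
        (abs_add_le _ _).trans (add_le_add (abs_add_le _ _) le_rfl)
    _ ≤ c * (1 + s) + c * Be + c * Bo := add_le_add (add_le_add hx he) ho
    _ = c * ((1 + s) + (Be + Bo)) := by ring
    _ ≤ c * ((1 / L + 1 + (Be + Bo) / L) * s) := mul_le_mul_of_nonneg_left key hc
    _ ≤ c * (K * s) := mul_le_mul_of_nonneg_left (mul_le_mul_of_nonneg_right hK hs0) hc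
    _ = K * c * s := by ring

/-! ### The registered helper stub -/

/-- **Helper stub `stub_reorthCutPrelim`** (file 1 of 2 of `stub_reorthCut`, line `rare-band-ladder-dock`): the two
orthogonality mechanisms of the cut — (i) the difference of two continuous quadratic-growth profiles orthogonal to
`c₀ + ⟪b, w⟫ + c₂‖w‖²` under `γ` is orthogonal to it; (ii) for radial weights `0 ≤ ζ_A, ζ_B ≤ 1` and coefficients
`(a₀, a₄, a)` solving the block-diagonal Gram system, `F − a₀ζ_A − a₄ζ_B − (∑ a_k w_k)ζ_A` is orthogonal to every
`c₀ + ⟪b, w⟫ + c₂‖w‖²`. -/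
def ReorthCutPrelim : Prop :=
  (∀ (g G : V3 → ℝ), Continuous g → Continuous G → ∀ K K' : ℝ,
    (∀ w, |g w| ≤ K * (1 + ‖w‖ ^ 2)) → (∀ w, |G w| ≤ K' * (1 + ‖w‖ ^ 2)) → ∀ (c₀ c₂ : ℝ) (b : V3),
    ∫ v, g v * (c₀ + inner ℝ b v + c₂ * ‖v‖ ^ 2) ∂stdGaussian V3 = 0 →
    ∫ v, G v * (c₀ + inner ℝ b v + c₂ * ‖v‖ ^ 2) ∂stdGaussian V3 = 0 →
    ∫ v, (g v - G v) * (c₀ + inner ℝ b v + c₂ * ‖v‖ ^ 2) ∂stdGaussian V3 = 0) ∧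
  (∀ (F : V3 → ℝ) (ζA ζB : ℝ → ℝ), Continuous F → ∀ KF : ℝ, (∀ w, |F w| ≤ KF * (1 + ‖w‖ ^ 2)) →
    Continuous ζA → (∀ s, 0 ≤ ζA s) → (∀ s, ζA s ≤ 1) →
    Continuous ζB → (∀ s, 0 ≤ ζB s) → (∀ s, ζB s ≤ 1) → ∀ (a₀ a₄ : ℝ) (a : V3),
    a₀ * ∫ w, ζA (‖w‖ ^ 2) ∂stdGaussian V3 + a₄ * ∫ w, ζB (‖w‖ ^ 2) ∂stdGaussian V3 =
      ∫ w, F w ∂stdGaussian V3 →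
    (∀ j, a j * ∫ w, w 0 * w 0 * ζA (‖w‖ ^ 2) ∂stdGaussian V3 = ∫ w, F w * w j ∂stdGaussian V3) →
    a₀ * ∫ w, ζA (‖w‖ ^ 2) * ‖w‖ ^ 2 ∂stdGaussian V3 + a₄ * ∫ w, ζB (‖w‖ ^ 2) * ‖w‖ ^ 2 ∂stdGaussian V3 =
      ∫ w, F w * ‖w‖ ^ 2 ∂stdGaussian V3 →
    ∀ (c₀ c₂ : ℝ) (b : V3),
    ∫ v, (F v - (a₀ * ζA (‖v‖ ^ 2) + a₄ * ζB (‖v‖ ^ 2)) - (∑ k, a k * v k) * ζA (‖v‖ ^ 2)) *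
      (c₀ + inner ℝ b v + c₂ * ‖v‖ ^ 2) ∂stdGaussian V3 = 0)

/-- **Registered helper stub `stub_reorthCutPrelim`**: `orth_sub` and `orth_corr`, packaged. [folklore] -/
theorem stub_reorthCutPrelim : ReorthCutPrelim :=
  ⟨fun _ _ hgc hGc _ _ hgb hGb c₀ c₂ b hg hG => orth_sub hgc hGc hgb hGb c₀ c₂ b hg hG,
    fun _ _ _ hFc _ hFb hA hA0 hA1 hB hB0 hB1 _ _ _ e₀ e e₄ c₀ c₂ b =>
      orth_corr hFc hFb hA hA0 hA1 hB hB0 hB1 e₀ e e₄ c₀ c₂ b⟩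

end Summit.AtomisticToContinuum.HydrodynamicLimit.Theorems.KineticWindowGronwallReorthCut

end
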